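import Literature.MathematicalPhysics.KineticTheory.GoodConfigurationsMeasure
import HarnessLib

/-!
# Tuning of the bad-set parameters in the proof of BGSR Proposition 5.8
(Bodineau–Gallagher–Saint-Raymond, Invent. Math. 203 (2016) = arXiv:1305.3397v2, §5.3.4, proof of
Proposition 5.8, p. 21 of the held text: *"To derive the upper bound (5.28), we choose for the
parameters the following orders of magnitude `δ ∼ ε^{(d-1)/(d+1)}`, `ε₀ ∼ ε^{d/(d+1)}`,
`E ∼ √|log ε|`, `ā = A^{K+1} ε`. This leads to `‖f_N^{(1,K)} - g_α^{(1,K)}‖ ≤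
(Cαt)^{A^{K+1}} A^{2K(K+1)} (ε^{(d-1)/(d+1)} |log ε|^d + ε^{d-1}) ‖ρ⁰‖_∞`"*; trunk T-KINETIC, topic
MathematicalPhysics/KineticTheory; the real-analysis part of the last glue step towards the named
fact `bgsr_linearBoltzmannApprox` (`TaggedSphereDiffusion`) recorded in `TaggedSphereLinearBoltzmannRate`.)

With the honest rate of the post-collisional bad set (`GoodConfigurationsMeasure`: linear in the
cylinder radii up to the optimisation `A/λ + Bλ`, instead of the printed `(ā/ε₀)^{d-1}`), the
tree's tuning is, in terms of `s = ε^{1/6}`: `δ = s²`, `ε₀ = s⁴`, `λ = s`, `ā = a₀ ε` with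
`a₀ = 3 √(log(N+1))` (`≥ L_K + 1`), `E² = (4/β) |log ε|`, `W = 3E`. This file PROVES the
elementary estimate that this tuning makes the measure (5.9) of the bad sets of Prop. 5.1 a
polynomial in the large parameters times `s = ε^{1/6}`:

* `sphereMeasure_prod_bgsrBadSet_le_of_tuning` — for `0 < s ≤ 1`, `12 a₀ s² ≤ 1`, `s⁴ ≤ 1/12`,
  `s² ≤ E`, and an `ε₀`-separated partner,
  `(σ ⊗ dv) {(ν, v) : |v| ≤ E, (ν, v) ∈ bgsrBadSet t (a₀ s⁶) (s⁴) (s²) (3E) Y m}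
   ≤ 117 d s B^{5d+3} |B₁|²`, `B = 36 + k + 4E + (6tE + 2) + a₀`.

## References

* T. Bodineau, I. Gallagher, L. Saint-Raymond, *The Brownian motion as the limit of a
  deterministic system of hard-spheres*, Invent. Math. 203 (2016) 493–553 = arXiv:1305.3397v2,
  §5.3.4 Prop. 5.8 proof, p. 21.
-/

open MeasureTheory Metric Real Set Filter Function
open scoped InnerProductSpace ENNReal
open Literature.Analysis.FluidPDE (Config)

namespace Literature.MathematicalPhysics.KineticTheory

noncomputable section

open Literature.Analysis.FunctionSpaces.Torus Literature.Analysis.FluidPDE.Torus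

section Kinetic

variable {d : Type*} [Fintype d] [DecidableEq d]

/-! ## Powers of a small parameter -/

omit [Fintype d] [DecidableEq d] in
/-- `(s²)^m ≤ s` for `0 ≤ s ≤ 1`, `m ≥ 1`. [folklore] -/
theorem sq_pow_le_self {s : ℝ} (hs : 0 ≤ s) (hs1 : s ≤ 1) {m : ℕ} (hm : 1 ≤ m) : (s ^ 2) ^ m ≤ s := by
  calc (s ^ 2) ^ m ≤ (s ^ 2) ^ 1 := pow_le_pow_of_le_one (by positivity) (by nlinarith) hm
    _ = s * s := by ring
    _ ≤ 1 * s := mul_le_mul_of_nonneg_right hs1 hs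
    _ = s := one_mul s

omit [Fintype d] [DecidableEq d] in
/-- `s^a ≤ s` for `0 ≤ s ≤ 1`, `a ≥ 1`. [folklore] -/
theorem pow_le_self_of_le_one' {s : ℝ} (hs : 0 ≤ s) (hs1 : s ≤ 1) {a : ℕ} (ha : 1 ≤ a) : s ^ a ≤ s := by
  calc s ^ a ≤ s ^ 1 := pow_le_pow_of_le_one hs hs1 ha
    _ = s := pow_one s

/-! ## The bad sets of Prop. 5.1 under the tuning -/

set_option maxHeartbeats 1000000 in
/-- **The measure (5.9) of the bad sets under the tree's tuning.** With `s ∈ (0, 1]`,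
`ā = a₀ s⁶`, `ε₀ = s⁴`, `δ = s²`, `λ = s`, `W = 3E` (`E > 0`, `a₀ ≥ 1`, `12 a₀ s² ≤ 1`,
`s⁴ ≤ 1/12`, `s² ≤ E`, `t ≥ 0`, `d ≥ 2`) and a partner `m` that is `ε₀`-separated from the
other particles of `Y`, the bad set of Prop. 5.1 restricted to `B_E` has `σ ⊗ dv`-measure at
most `117 d s B^{5d+3} |B₁|²`, `B = 36 + k + 4E + (6tE + 2) + a₀`
(`sphereMeasure_prod_bgsrBadSet_le` and bookkeeping: every small quantity of (5.9) carries at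
least one factor `s`, every large one is at most `B`).
[cite: BodineauGallagherSaintRaymondInvent2016, §5.3.4 Prop. 5.8 proof, p. 21] -/
theorem sphereMeasure_prod_bgsrBadSet_le_of_tuning (hd : 2 ≤ Fintype.card d) {s : ℝ} (hs : 0 < s)
    (hs1 : s ≤ 1) {k : ℕ} {t E a₀ : ℝ} (ht : 0 ≤ t) (hE : 0 < E) (ha₀ : 1 ≤ a₀)
    (h12 : 12 * a₀ * s ^ 2 ≤ 1) (hε₀ : s ^ 4 ≤ 1 / 12) (hδE : s ^ 2 ≤ E)
    {Y : Config k d (UnitAddTorus d)} {m : Fin k}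
    (hsep : ∀ j : Fin k, j ≠ m → s ^ 4 ≤ euclidDist (Y m).1 (Y j).1) :
    ((sphereMeasure (E := EuclideanSpace ℝ d)).prod volume)
        {p : sphere (0 : EuclideanSpace ℝ d) 1 × EuclideanSpace ℝ d |
          ‖p.2‖ ≤ E ∧ ((p.1 : EuclideanSpace ℝ d), p.2) ∈ bgsrBadSet t (a₀ * s ^ 6) (s ^ 4) (s ^ 2) (3 * E) Y m} ≤
      ENNReal.ofReal (s * (117 * Fintype.card d *
          (36 + k + 4 * E + (6 * (t * E) + 2) + a₀) ^ (5 * Fintype.card d + 3)) *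
        (volume (ball (0 : EuclideanSpace ℝ d) 1)).toReal ^ 2) := by
  set n := Fintype.card d with hn
  set B : ℝ := 36 + k + 4 * E + (6 * (t * E) + 2) + a₀ with hB
  set V := volume (ball (0 : EuclideanSpace ℝ d) 1) with hV
  have hn1 : 1 ≤ n - 1 := by omega
  have hn0 : 1 ≤ n := by omega
  have hs0 := hs.le
  have hE0 := hE.le
  have hk0 : (0 : ℝ) ≤ k := Nat.cast_nonneg k
  have ha0 : 0 ≤ a₀ := zero_le_one.trans ha₀
  have hB36 : 36 ≤ B := by rw [hB]; nlinarith [mul_nonneg ht hE0]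
  have hB1 : 1 ≤ B := by linarith
  have hB0 : 0 ≤ B := by linarith
  have hkB : (k : ℝ) ≤ B := by rw [hB]; nlinarith [mul_nonneg ht hE0]
  have hEB : E ≤ B := by rw [hB]; nlinarith [mul_nonneg ht hE0]
  have hWB : 3 * E ≤ B := by rw [hB]; nlinarith [mul_nonneg ht hE0]
  have hPB : 2 * (t * (3 * E)) + 2 ≤ B := by rw [hB]; nlinarith [mul_nonneg ht hE0]
  have haB : a₀ ≤ B := by rw [hB]; nlinarith [mul_nonneg ht hE0]
  -- the measure bound of Prop. 5.1 with `ā = a₀ s⁶`, `ε₀ = s⁴`, `δ = s²`, `W = 3E`, `λ = s`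
  have hā : 0 < a₀ * s ^ 6 := by positivity
  have hāε₀ : 12 * (a₀ * s ^ 6) ≤ s ^ 4 := by
    have : 12 * (a₀ * s ^ 6) = (12 * a₀ * s ^ 2) * s ^ 4 := by ring
    rw [this]
    exact mul_le_of_le_one_left (by positivity) h12
  have hδ : 0 < s ^ 2 := by positivity
  have hδW : 3 * s ^ 4 / s ^ 2 ≤ 3 * E := by
    rw [show 3 * s ^ 4 / s ^ 2 = 3 * s ^ 2 by field_simp]
    linarith
  have h59 := sphereMeasure_prod_bgsrBadSet_le (d := d) (t := t) hā hāε₀ hε₀ hδ hδW ht hE hs hd hsep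
  refine h59.trans ?_
  -- rewrite the powers of the unit-ball volume
  have hVfin : V ≠ ∞ := (measure_ball_lt_top).ne
  have hVeq : V = ENNReal.ofReal V.toReal := (ENNReal.ofReal_toReal hVfin).symm
  -- the small quantities
  have e1 : 6 * (a₀ * s ^ 6) / s ^ 4 = 6 * a₀ * s ^ 2 := by field_simp
  have e2 : 3 * s ^ 4 / s ^ 2 = 3 * s ^ 2 := by field_simp
  have e3 : (6 * (2 * (a₀ * s ^ 6)) * (3 * E) / s ^ 4 + 12 * (2 * (a₀ * s ^ 6)) * (3 * E)) / s =
      12 * a₀ * (3 * E) * s + 24 * a₀ * (3 * E) * s ^ 5 := by field_simp; ring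
  have e4 : (3 * s ^ 4 / s ^ 2 + 12 * s ^ 4 * (3 * E)) / s = 3 * s + 12 * (3 * E) * s ^ 3 := by
    field_simp
  have l1 : (6 * (a₀ * s ^ 6) / s ^ 4) ^ (n - 1) ≤ (6 * a₀) ^ (n - 1) * s := by
    rw [e1, show 6 * a₀ * s ^ 2 = (6 * a₀) * s ^ 2 by ring, mul_pow]
    exact mul_le_mul_of_nonneg_left (sq_pow_le_self hs0 hs1 hn1) (by positivity)
  have l2 : (6 * s ^ 4) ^ (n - 1) ≤ 6 ^ (n - 1) * s := by
    rw [mul_pow]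
    refine mul_le_mul_of_nonneg_left ?_ (by positivity)
    calc (s ^ 4) ^ (n - 1) = (s ^ 2) ^ (2 * (n - 1)) := by rw [← pow_mul, ← pow_mul]; ring_nf
      _ ≤ s := sq_pow_le_self hs0 hs1 (by omega)
  have l3 : (3 * s ^ 4 / s ^ 2) ^ (n - 1) ≤ 3 ^ (n - 1) * s := by
    rw [e2, mul_pow]
    exact mul_le_mul_of_nonneg_left (sq_pow_le_self hs0 hs1 hn1) (by positivity)
  have l3' : (3 * s ^ 4 / s ^ 2) ^ n ≤ 3 ^ n * s := by
    rw [e2, mul_pow]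
    exact mul_le_mul_of_nonneg_left (sq_pow_le_self hs0 hs1 hn0) (by positivity)
  have l4 : 12 * s ^ 4 * (3 * E) ≤ 12 * s * (3 * E) := by
    have := pow_le_self_of_le_one' hs0 hs1 (a := 4) (by norm_num)
    gcongr
  have l6 : (6 * (2 * (a₀ * s ^ 6)) * (3 * E) / s ^ 4 + 12 * (2 * (a₀ * s ^ 6)) * (3 * E)) / s ≤
      36 * a₀ * (3 * E) * s := by
    rw [e3]
    have h5 : s ^ 5 ≤ s := pow_le_self_of_le_one' hs0 hs1 (by norm_num)
    nlinarith [mul_nonneg ha0 hE0, mul_nonneg (mul_nonneg ha0 hE0) hs0]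
  have l7 : (3 * s ^ 4 / s ^ 2 + 12 * s ^ 4 * (3 * E)) / s ≤ (3 + 12 * (3 * E)) * s := by
    rw [e4]
    have h3 : s ^ 3 ≤ s := pow_le_self_of_le_one' hs0 hs1 (by norm_num)
    nlinarith [mul_nonneg hE0 hs0]
  -- substitute the small quantities (same tree shape, monotone in the leaves)
  set P : ℝ := (2 * (t * (3 * E)) + 2) ^ n with hP
  have hP0 : 0 ≤ P := by positivity
  have hmain : (n : ℝ) * ((k : ℝ) * (2 * 6 ^ n * (3 * E) ^ n * ((6 * (a₀ * s ^ 6) / s ^ 4) ^ (n - 1) + 3 * P * (6 * s ^ 4) ^ (n - 1)) + 4 * 2 ^ n * (3 * E) * (3 * s ^ 4 / s ^ 2) ^ (n - 1)) + ((3 * s ^ 4 / s ^ 2) ^ n + 2 ^ (n + 3) * (P * E ^ (n - 1) * (12 * s ^ 4 * (3 * E)) + 2 * (k : ℝ) * (P * (s * E ^ n + E ^ (n - 1) * ((6 * (2 * (a₀ * s ^ 6)) * (3 * E) / s ^ 4 + 12 * (2 * (a₀ * s ^ 6)) * (3 * E)) / s)) + (P + 1) * (s * E ^ n + E ^ (n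 - 1) * ((3 * s ^ 4 / s ^ 2 + 12 * s ^ 4 * (3 * E)) / s)))))) ≤
      (n : ℝ) * ((k : ℝ) * (2 * 6 ^ n * (3 * E) ^ n * ((6 * a₀) ^ (n - 1) * s + 3 * P * (6 ^ (n - 1) * s)) + 4 * 2 ^ n * (3 * E) * (3 ^ (n - 1) * s)) + (3 ^ n * s + 2 ^ (n + 3) * (P * E ^ (n - 1) * (12 * s * (3 * E)) + 2 * (k : ℝ) * (P * (s * E ^ n + E ^ (n - 1) * (36 * a₀ * (3 * E) * s)) + (P + 1) * (s * E ^ n + E ^ (n - 1) * ((3 + 12 * (3 * E)) * s)))))) := by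
    gcongr
  -- the large quantities
  have hQ : (n : ℝ) * ((k : ℝ) * (2 * 6 ^ n * (3 * E) ^ n * ((6 * a₀) ^ (n - 1) * s + 3 * P * (6 ^ (n - 1) * s)) + 4 * 2 ^ n * (3 * E) * (3 ^ (n - 1) * s)) + (3 ^ n * s + 2 ^ (n + 3) * (P * E ^ (n - 1) * (12 * s * (3 * E)) + 2 * (k : ℝ) * (P * (s * E ^ n + E ^ (n - 1) * (36 * a₀ * (3 * E) * s)) + (P + 1) * (s * E ^ n + E ^ (n - 1) * ((3 + 12 * (3 * E)) * s)))))) ≤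
      s * (117 * n * B ^ (5 * n + 3)) := by
    -- every atom is at most `B`, and `B ≥ 36`
    have hPle : P ≤ B ^ n := by rw [hP]; exact pow_le_pow_left₀ (by positivity) hPB n
    have h6B : (6 : ℝ) ≤ B := le_trans (by norm_num) hB36
    have h3B : (3 : ℝ) ≤ B := le_trans (by norm_num) hB36
    have h2B : (2 : ℝ) ≤ B := le_trans (by norm_num) hB36
    have h6n : (6 : ℝ) ^ n ≤ B ^ n := pow_le_pow_left₀ (by norm_num) h6B n
    have h6n1 : (6 : ℝ) ^ (n - 1) ≤ B ^ (n - 1) := pow_le_pow_left₀ (by norm_num) h6B (n - 1)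
    have h3n1 : (3 : ℝ) ^ (n - 1) ≤ B ^ (n - 1) := pow_le_pow_left₀ (by norm_num) h3B (n - 1)
    have h3n : (3 : ℝ) ^ n ≤ B ^ n := pow_le_pow_left₀ (by norm_num) h3B n
    have h2n : (2 : ℝ) ^ (n + 3) ≤ 8 * B ^ n := by
      have h := pow_le_pow_left₀ (by norm_num : (0 : ℝ) ≤ 2) h2B n
      rw [pow_add]
      norm_num
      linarith
    have hWn : (3 * E) ^ n ≤ B ^ n := pow_le_pow_left₀ (by positivity) hWB n
    have hEn : E ^ n ≤ B ^ n := pow_le_pow_left₀ hE0 hEB n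
    have hEn1 : E ^ (n - 1) ≤ B ^ (n - 1) := pow_le_pow_left₀ hE0 hEB (n - 1)
    have haB' : (6 * a₀) ^ (n - 1) ≤ (B * B) ^ (n - 1) :=
      pow_le_pow_left₀ (by positivity) (by nlinarith) (n - 1)
    have h15 : 3 + 12 * (3 * E) ≤ B * B := by nlinarith
    have h12B : (12 : ℝ) ≤ B := le_trans (by norm_num) hB36
    have h36B : 36 * a₀ * (3 * E) ≤ B * B * B := by
      have h1 : a₀ * (3 * E) ≤ B * B := mul_le_mul haB hWB (by positivity) hB0
      have h2 : (36 : ℝ) * (a₀ * (3 * E)) ≤ B * (B * B) := mul_le_mul hB36 h1 (by positivity) hB0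
      linarith [h2]
    -- powers of `B` are at most `B^{4n+3}`
    have hBp : ∀ (a : ℕ), a ≤ 4 * n + 3 → B ^ a ≤ B ^ (4 * n + 3) := fun a ha => pow_le_pow_right₀ hB1 ha
    have hBB : B * B = B ^ 2 := by ring
    -- monomial bounds
    have m1 : (k : ℝ) * (2 * 6 ^ n * (3 * E) ^ n * ((6 * a₀) ^ (n - 1) * s)) ≤ 2 * B ^ (4 * n + 3) * s := by
      calc (k : ℝ) * (2 * 6 ^ n * (3 * E) ^ n * ((6 * a₀) ^ (n - 1) * s))
          ≤ B * (2 * B ^ n * B ^ n * ((B * B) ^ (n - 1) * s)) := by gcongr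
        _ = 2 * (B ^ (1 + n + n) * (B ^ 2) ^ (n - 1)) * s := by rw [hBB]; ring
        _ = 2 * B ^ (1 + n + n + 2 * (n - 1)) * s := by rw [← pow_mul, ← pow_add]
        _ ≤ 2 * B ^ (4 * n + 3) * s :=
          mul_le_mul_of_nonneg_right (mul_le_mul_of_nonneg_left (hBp (1 + n + n + 2 * (n - 1)) (by omega))
            (by norm_num)) hs0
    have m2 : (k : ℝ) * (2 * 6 ^ n * (3 * E) ^ n * (3 * P * (6 ^ (n - 1) * s))) ≤ 6 * B ^ (4 * n + 3) * s := by
      calc (k : ℝ) * (2 * 6 ^ n * (3 * E) ^ n * (3 * P * (6 ^ (n - 1) * s)))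
          ≤ B * (2 * B ^ n * B ^ n * (3 * B ^ n * (B ^ (n - 1) * s))) := by gcongr
        _ = 6 * B ^ (1 + n + n + n + (n - 1)) * s := by simp only [pow_add]; ring
        _ ≤ 6 * B ^ (4 * n + 3) * s :=
          mul_le_mul_of_nonneg_right (mul_le_mul_of_nonneg_left (hBp (1 + n + n + n + (n - 1)) (by omega))
            (by norm_num)) hs0
    have m3 : (k : ℝ) * (4 * 2 ^ n * (3 * E) * (3 ^ (n - 1) * s)) ≤ 4 * B ^ (4 * n + 3) * s := by
      have h2n' : (2 : ℝ) ^ n ≤ B ^ n := pow_le_pow_left₀ (by norm_num) h2B n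
      calc (k : ℝ) * (4 * 2 ^ n * (3 * E) * (3 ^ (n - 1) * s)) ≤ B * (4 * B ^ n * B * (B ^ (n - 1) * s)) := by gcongr
        _ = 4 * B ^ (1 + n + 1 + (n - 1)) * s := by simp only [pow_add, pow_one]; ring
        _ ≤ 4 * B ^ (4 * n + 3) * s :=
          mul_le_mul_of_nonneg_right (mul_le_mul_of_nonneg_left (hBp (1 + n + 1 + (n - 1)) (by omega))
            (by norm_num)) hs0
    have m4 : (3 : ℝ) ^ n * s ≤ B ^ (4 * n + 3) * s := by
      calc (3 : ℝ) ^ n * s ≤ B ^ n * s := by gcongr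
        _ ≤ B ^ (4 * n + 3) * s := mul_le_mul_of_nonneg_right (hBp n (by omega)) hs0
    have m5 : P * E ^ (n - 1) * (12 * s * (3 * E)) ≤ B ^ (4 * n + 3) * s := by
      calc P * E ^ (n - 1) * (12 * s * (3 * E)) ≤ B ^ n * B ^ (n - 1) * (B * s * B) := by gcongr
        _ = B ^ (n + (n - 1) + 1 + 1) * s := by simp only [pow_add, pow_one]; ring
        _ ≤ B ^ (4 * n + 3) * s := mul_le_mul_of_nonneg_right (hBp (n + (n - 1) + 1 + 1) (by omega)) hs0
    have m6 : 2 * (k : ℝ) * (P * (s * E ^ n + E ^ (n - 1) * (36 * a₀ * (3 * E) * s))) ≤ 4 * B ^ (4 * n + 3) * s := by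
      calc 2 * (k : ℝ) * (P * (s * E ^ n + E ^ (n - 1) * (36 * a₀ * (3 * E) * s)))
          ≤ 2 * B * (B ^ n * (s * B ^ n + B ^ (n - 1) * (B * B * B * s))) := by gcongr
        _ = 2 * (B ^ (1 + n + n) + B ^ (1 + n + (n - 1) + 1 + 1 + 1)) * s := by
            simp only [pow_add, pow_one]; ring
        _ ≤ 2 * (B ^ (4 * n + 3) + B ^ (4 * n + 3)) * s :=
          mul_le_mul_of_nonneg_right (mul_le_mul_of_nonneg_left
            (add_le_add (hBp (1 + n + n) (by omega)) (hBp (1 + n + (n - 1) + 1 + 1 + 1) (by omega)))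
            (by norm_num)) hs0
        _ = 4 * B ^ (4 * n + 3) * s := by ring
    have m7 : 2 * (k : ℝ) * ((P + 1) * (s * E ^ n + E ^ (n - 1) * ((3 + 12 * (3 * E)) * s))) ≤
        8 * B ^ (4 * n + 3) * s := by
      have hP1 : P + 1 ≤ 2 * B ^ n := by
        have : (1 : ℝ) ≤ B ^ n := one_le_pow₀ hB1
        linarith
      calc 2 * (k : ℝ) * ((P + 1) * (s * E ^ n + E ^ (n - 1) * ((3 + 12 * (3 * E)) * s)))
          ≤ 2 * B * ((2 * B ^ n) * (s * B ^ n + B ^ (n - 1) * ((B * B) * s))) := by gcongr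
        _ = 4 * (B ^ (1 + n + n) + B ^ (1 + n + (n - 1) + 1 + 1)) * s := by
            simp only [pow_add, pow_one]; ring
        _ ≤ 4 * (B ^ (4 * n + 3) + B ^ (4 * n + 3)) * s :=
          mul_le_mul_of_nonneg_right (mul_le_mul_of_nonneg_left
            (add_le_add (hBp (1 + n + n) (by omega)) (hBp (1 + n + (n - 1) + 1 + 1) (by omega)))
            (by norm_num)) hs0
        _ = 8 * B ^ (4 * n + 3) * s := by ring
    -- combine
    have hkg : (k : ℝ) * (2 * 6 ^ n * (3 * E) ^ n * ((6 * a₀) ^ (n - 1) * s + 3 * P * (6 ^ (n - 1) * s)) + 4 * 2 ^ n * (3 * E) * (3 ^ (n - 1) * s)) ≤ 12 * B ^ (4 * n + 3) * s := by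
      have e : (k : ℝ) * (2 * 6 ^ n * (3 * E) ^ n * ((6 * a₀) ^ (n - 1) * s + 3 * P * (6 ^ (n - 1) * s)) + 4 * 2 ^ n * (3 * E) * (3 ^ (n - 1) * s)) =
          (k : ℝ) * (2 * 6 ^ n * (3 * E) ^ n * ((6 * a₀) ^ (n - 1) * s)) +
            (k : ℝ) * (2 * 6 ^ n * (3 * E) ^ n * (3 * P * (6 ^ (n - 1) * s))) +
            (k : ℝ) * (4 * 2 ^ n * (3 * E) * (3 ^ (n - 1) * s)) := by ring
      rw [e]
      have h := add_le_add (add_le_add m1 m2) m3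
      linarith [h]
    have hpost : 3 ^ n * s + 2 ^ (n + 3) * (P * E ^ (n - 1) * (12 * s * (3 * E)) + 2 * (k : ℝ) * (P * (s * E ^ n + E ^ (n - 1) * (36 * a₀ * (3 * E) * s)) + (P + 1) * (s * E ^ n + E ^ (n - 1) * ((3 + 12 * (3 * E)) * s)))) ≤
        B ^ (4 * n + 3) * s + 8 * B ^ n * (13 * B ^ (4 * n + 3) * s) := by
      have hin : P * E ^ (n - 1) * (12 * s * (3 * E)) + 2 * (k : ℝ) * (P * (s * E ^ n + E ^ (n - 1) * (36 * a₀ * (3 * E) * s)) + (P + 1) * (s * E ^ n + E ^ (n - 1) * ((3 + 12 * (3 * E)) * s))) ≤ 13 * B ^ (4 * n + 3) * s := by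
        have : 2 * (k : ℝ) * (P * (s * E ^ n + E ^ (n - 1) * (36 * a₀ * (3 * E) * s)) + (P + 1) * (s * E ^ n + E ^ (n - 1) * ((3 + 12 * (3 * E)) * s))) =
            2 * (k : ℝ) * (P * (s * E ^ n + E ^ (n - 1) * (36 * a₀ * (3 * E) * s))) +
              2 * (k : ℝ) * ((P + 1) * (s * E ^ n + E ^ (n - 1) * ((3 + 12 * (3 * E)) * s))) := by ring
        rw [this]
        have h := add_le_add (add_le_add m5 m6) m7
        linarith [h]
      have hin0 : 0 ≤ P * E ^ (n - 1) * (12 * s * (3 * E)) + 2 * (k : ℝ) * (P * (s * E ^ n + E ^ (n - 1) * (36 * a₀ * (3 * E) * s)) + (P + 1) * (s * E ^ n + E ^ (n - 1) * ((3 + 12 * (3 * E)) * s))) := by positivity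
      exact add_le_add m4 (mul_le_mul h2n hin hin0 (by positivity))
    have h45 : B ^ (4 * n + 3) ≤ B ^ (5 * n + 3) := pow_le_pow_right₀ hB1 (by omega)
    have h5 : B ^ n * B ^ (4 * n + 3) = B ^ (5 * n + 3) := by rw [← pow_add]; congr 1; omega
    have hsum : (k : ℝ) * (2 * 6 ^ n * (3 * E) ^ n * ((6 * a₀) ^ (n - 1) * s + 3 * P * (6 ^ (n - 1) * s)) + 4 * 2 ^ n * (3 * E) * (3 ^ (n - 1) * s)) + (3 ^ n * s + 2 ^ (n + 3) * (P * E ^ (n - 1) * (12 * s * (3 * E)) + 2 * (k : ℝ) * (P * (s * E ^ n + E ^ (n - 1) * (36 * a₀ * (3 * E) * s)) + (P + 1) * (s * E ^ n + E ^ (n - 1) * ((3 + 12 * (3 * E)) * s))))) ≤ 117 * B ^ (5 * n + 3) * s := by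
      calc (k : ℝ) * (2 * 6 ^ n * (3 * E) ^ n * ((6 * a₀) ^ (n - 1) * s + 3 * P * (6 ^ (n - 1) * s)) + 4 * 2 ^ n * (3 * E) * (3 ^ (n - 1) * s)) + (3 ^ n * s + 2 ^ (n + 3) * (P * E ^ (n - 1) * (12 * s * (3 * E)) + 2 * (k : ℝ) * (P * (s * E ^ n + E ^ (n - 1) * (36 * a₀ * (3 * E) * s)) + (P + 1) * (s * E ^ n + E ^ (n - 1) * ((3 + 12 * (3 * E)) * s)))))
          ≤ 12 * B ^ (4 * n + 3) * s + (B ^ (4 * n + 3) * s + 8 * B ^ n * (13 * B ^ (4 * n + 3) * s)) :=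
            add_le_add hkg hpost
        _ = 13 * (B ^ (4 * n + 3) * s) + 104 * (B ^ n * B ^ (4 * n + 3)) * s := by ring
        _ ≤ 13 * (B ^ (5 * n + 3) * s) + 104 * B ^ (5 * n + 3) * s := by
            rw [h5]
            have : B ^ (4 * n + 3) * s ≤ B ^ (5 * n + 3) * s := mul_le_mul_of_nonneg_right h45 hs0
            linarith
        _ = 117 * B ^ (5 * n + 3) * s := by ring
    refine le_trans (mul_le_mul_of_nonneg_left hsum (Nat.cast_nonneg n)) (le_of_eq ?_)
    ring
  -- conclude in `ℝ≥0∞`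
  have hQ0 : 0 ≤ s * (117 * n * B ^ (5 * n + 3)) := by positivity
  calc ENNReal.ofReal ((n : ℝ) * ((k : ℝ) * (2 * 6 ^ n * (3 * E) ^ n * ((6 * (a₀ * s ^ 6) / s ^ 4) ^ (n - 1) + 3 * P * (6 * s ^ 4) ^ (n - 1)) + 4 * 2 ^ n * (3 * E) * (3 * s ^ 4 / s ^ 2) ^ (n - 1)) + ((3 * s ^ 4 / s ^ 2) ^ n + 2 ^ (n + 3) * (P * E ^ (n - 1) * (12 * s ^ 4 * (3 * E)) + 2 * (k : ℝ) * (P * (s * E ^ n + E ^ (n - 1) * ((6 * (2 * (a₀ * s ^ 6)) * (3 * E) / s ^ 4 + 12 * (2 * (a₀ * s ^ 6)) * (3 * E)) / s)) + (P + 1) * (s * E ^ n + E ^ (n - 1) * ((3 * s ^ 4 / s ^ 2 + 12 * s ^ 4 * (3 * E)) / s))))))) * V ^ 2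
      ≤ ENNReal.ofReal (s * (117 * n * B ^ (5 * n + 3))) * V ^ 2 :=
        mul_le_mul_of_nonneg_right (ENNReal.ofReal_le_ofReal (hmain.trans hQ)) zero_le
    _ = ENNReal.ofReal (s * (117 * n * B ^ (5 * n + 3)) * V.toReal ^ 2) := by
        conv_lhs => rw [hVeq]
        rw [← ENNReal.ofReal_pow ENNReal.toReal_nonneg, ← ENNReal.ofReal_mul hQ0]

end Kinetic

end

end Literature.MathematicalPhysics.KineticTheory
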